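import Mathlib
import Summits.NavierStokesRegularity.NavierStokesRegularity.Theorems.EulerZoomLiouvillePowerGaugeEulerLiouvilleCondenserComplexChart
import Summits.NavierStokesRegularity.NavierStokesRegularity.Theorems.EulerZoomLiouvillePowerGaugeEulerLiouvilleCondenserCrossings

/-!
# THE SHARP CONDENSER in `ℝ³` — crossings of the planes `⟪x,e⟫ = s`, `s ∈ [R, ΛR]`, through the circular-mean core on a
Euclidean disc of a weighted quiet slice (plate t47-B′, steps (1)–(6); nsreg-p2 g35 ROUND-45 §1/§6)

Width piece for crux `EulerZoomLiouville.PowerGaugeEulerLiouville` (stmt-NavierStokesRegularity-19832), by name under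
LEAD 19832 (ns-typeII-p2 g13); seat ns-sfl-p1 g6, `--supports stmt-NavierStokesRegularity-19832 --as helper`.

This is the t44-B assembly `Condenser.exp_le_gradient_or_small_of_crossings` / `…_of_exit` (ns-ezl-w2 g3) rebuilt on the
ROUND-45 components, with the two planar/slicing plates taken as NAMED HYPOTHESES whose texts are the `r45/Sketch45.lean`
Props VERBATIM (`hC` = `NsregP2.R45.CircleMeanCondenserCore`, t47-C; `hQ` = `NsregP2.R45.WeightedQuietSlice`, t47-Q — both
being typed by ns-ezl-w2 g4; once landed they discharge `hC`/`hQ` by name):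

* `exists_slice_alternative_of_crossings` — STATIC FORM: `V ∈ C¹(ℝ³,ℝ³)`, unit `e`, exit ratio `Λ > 1`, ball budgets
  `X, Y` on `B(0,(Λ+1)R)`, `‖DV‖ ≤ G_m` there, every plane `⟪x,e⟫ = s`, `s ∈ [R,ΛR]`, crossed anomalously inside
  `B̄(0,ΛR)`; then some height `s ∈ [R,ΛR]` satisfies the t47-C alternative with `m = γs`, `r = R/2`,
  `A = X/(η(Λ−1)R)`, `E = 3Y s²/(((1+(1−η)(Λ−1))³−1)R³)`:
  `(1−δ)γs ≤ √(2A/π)/r  ∨  (δγs/r)·exp(2π((1−δ)γs − √(2A/π)/r)²/E) ≤ G_m`.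
  [rotate `e ↦ e₂` (`exists_linearIsometryEquiv_apply_eq`), weighted quiet slice (`hQ`), anomalous point on it, the
  `ℂ`-chart t47-X at that point with the scalar `ψ = ⟪W∘Φ, u⟫`, `u = W(y₁)/‖W(y₁)‖`, disc budgets
  `setIntegral_cdisc_sq_inner_le` / `setIntegral_cdisc_sq_norm_fderiv_inner_le`, core `hC`.]
* `exists_slice_alternative_of_exit` — DYNAMIC FORM: the crossings come from ONE backward similarity orbit from `‖y‖ < R`
  to `‖Ψ_L y‖ ≥ ΛR` (t42a `exists_firstHit_of_exit` + `exists_anomalous_plane_of_exit`).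

HONEST FRAMING: real analysis in `ℝ³` (with a cut-off flow); nothing here proves the crux E (19832 OPEN), any door
Target, or any Navier–Stokes statement; no summit statement is touched. [folklore (length–area method);
cite: ConstantinIgnatovaVicol2026Putative, §3.4.1 for the setting]
-/

noncomputable section

open Set Filter Topology Metric Function MeasureTheory Real
open scoped RealInnerProductSpace

set_option linter.dupNamespace false

namespace Summit.NavierStokesRegularity.NavierStokesRegularity.Theorems.PowerGaugeEulerLiouville.Condenser

open Literature.Analysis Literature.Analysis.FluidPDE

/-- A vector paired with its own normalisation gives its norm: `⟪v, ‖v‖⁻¹ v⟫ = ‖v‖`. [folklore] -/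
theorem inner_self_normalize {H : Type*} [NormedAddCommGroup H] [InnerProductSpace ℝ H] (v : H) :
    ⟪v, (‖v‖⁻¹ : ℝ) • v⟫ = ‖v‖ := by
  rw [real_inner_smul_right, real_inner_self_eq_norm_sq]
  by_cases h : ‖v‖ = 0
  · rw [h]; simp
  · field_simp

/-- **THE SHARP CONDENSER, STATIC FORM (t47-B′ steps (2)–(6)).**  See the module docstring; `hC` and `hQ` are the texts
of `NsregP2.R45.CircleMeanCondenserCore` (t47-C) and `NsregP2.R45.WeightedQuietSlice` (t47-Q) verbatim.
[folklore (length–area method); cite: ConstantinIgnatovaVicol2026Putative, §3.4.1 for the setting] -/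
theorem exists_slice_alternative_of_crossings
    (hC : ∀ (ψ : ℂ → ℝ) (m G A E r δ : ℝ), ContDiff ℝ 1 ψ → 0 < m → m ≤ ψ 0 → 0 < r → 0 < δ → δ < 1 → 0 < E →
      (∀ z ∈ closedBall (0 : ℂ) r, ‖fderiv ℝ ψ z‖ ≤ G) →
      (∫ z in closedBall (0 : ℂ) r, ψ z ^ 2 ≤ A) →
      (∫ z in closedBall (0 : ℂ) r, ‖fderiv ℝ ψ z‖ ^ 2 ≤ E) →
      (1 - δ) * m ≤ Real.sqrt (2 * A / Real.pi) / r ∨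
        δ * m / r * Real.exp (2 * Real.pi * ((1 - δ) * m - Real.sqrt (2 * A / Real.pi) / r) ^ 2 / E) ≤ G)
    (hQ : ∀ (F G : EuclideanSpace ℝ (Fin 3) → ℝ), Continuous F → Continuous G → (∀ x, 0 ≤ F x) → (∀ x, 0 ≤ G x) →
      ∀ (R Λ R' η X Y : ℝ), 0 < R → 1 < Λ → 0 < η → η < 1 → 0 < X → 0 < Y →
        (∫ x in ball (0 : EuclideanSpace ℝ (Fin 3)) R', F x ≤ X) →
        (∫ x in ball (0 : EuclideanSpace ℝ (Fin 3)) R', G x ≤ Y) →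
        ∃ s ∈ Icc R (Λ * R),
          ∫ a, (ball (0 : EuclideanSpace ℝ (Fin 3)) R').indicator F (plane s a) ≤ X / (η * (Λ - 1) * R) ∧
          ∫ a, (ball (0 : EuclideanSpace ℝ (Fin 3)) R').indicator G (plane s a) ≤
            3 * Y / (((1 + (1 - η) * (Λ - 1)) ^ 3 - 1) * R ^ 3) * s ^ 2)
    {V : EuclideanSpace ℝ (Fin 3) → EuclideanSpace ℝ (Fin 3)} (hV : ContDiff ℝ 1 V)
    {e : EuclideanSpace ℝ (Fin 3)} (he : ‖e‖ = 1)
    {γ R Λ η δ X Y Gm : ℝ} (hγ : 0 < γ) (hR : 0 < R) (hΛ : 1 < Λ) (hη : 0 < η) (hη1 : η < 1)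
    (hδ : 0 < δ) (hδ1 : δ < 1) (hX : 0 < X) (hY : 0 < Y)
    (hA : ∫ x in ball (0 : EuclideanSpace ℝ (Fin 3)) ((Λ + 1) * R), ‖V x‖ ^ 2 ≤ X)
    (hE : ∫ x in ball (0 : EuclideanSpace ℝ (Fin 3)) ((Λ + 1) * R), ‖fderiv ℝ V x‖ ^ 2 ≤ Y)
    (hGm : ∀ z ∈ ball (0 : EuclideanSpace ℝ (Fin 3)) ((Λ + 1) * R), ‖fderiv ℝ V z‖ ≤ Gm)
    (hcross : ∀ s ∈ Icc R (Λ * R), ∃ y₁ : EuclideanSpace ℝ (Fin 3), ⟪y₁, e⟫ = s ∧ ‖y₁‖ ≤ Λ * R ∧ γ * s ≤ ‖V y₁‖) :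
    ∃ s ∈ Icc R (Λ * R),
      (1 - δ) * (γ * s) ≤ Real.sqrt (2 * (X / (η * (Λ - 1) * R)) / Real.pi) / (R / 2) ∨
        δ * (γ * s) / (R / 2) *
            Real.exp (2 * Real.pi * ((1 - δ) * (γ * s) - Real.sqrt (2 * (X / (η * (Λ - 1) * R)) / Real.pi) / (R / 2)) ^ 2 /
              (3 * Y / (((1 + (1 - η) * (Λ - 1)) ^ 3 - 1) * R ^ 3) * s ^ 2)) ≤ Gm := by
  -- rotate `e` to `e₂`
  set e₂ : EuclideanSpace ℝ (Fin 3) := EuclideanSpace.basisFun (Fin 3) ℝ 2 with he₂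
  have he₂1 : ‖e₂‖ = 1 := (EuclideanSpace.basisFun (Fin 3) ℝ).orthonormal.1 2
  obtain ⟨Rot, hRot⟩ := exists_linearIsometryEquiv_apply_eq he he₂1
  -- the rotated field (static transport only)
  set W : EuclideanSpace ℝ (Fin 3) → EuclideanSpace ℝ (Fin 3) := fun z => V (Rot.symm z) with hW
  have hWc : ContDiff ℝ 1 W := hV.comp Rot.symm.toContinuousLinearEquiv.contDiff
  have hWd : Differentiable ℝ W := hWc.differentiable one_ne_zero
  have hDW : ∀ x, ‖fderiv ℝ W x‖ = ‖fderiv ℝ V (Rot.symm x)‖ := norm_fderiv_comp_linearIsometryEquiv V Rot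
  -- ball budgets for `W`
  have hA' : ∫ x in ball (0 : EuclideanSpace ℝ (Fin 3)) ((Λ + 1) * R), ‖W x‖ ^ 2 ≤ X := by
    have h := setIntegral_ball_comp_linearIsometryEquiv (fun x => ‖V x‖ ^ 2) Rot ((Λ + 1) * R)
    simp only [hW]
    rw [h]; exact hA
  have hE' : ∫ x in ball (0 : EuclideanSpace ℝ (Fin 3)) ((Λ + 1) * R), ‖fderiv ℝ W x‖ ^ 2 ≤ Y := by
    have h := setIntegral_ball_comp_linearIsometryEquiv (fun x => ‖fderiv ℝ V x‖ ^ 2) Rot ((Λ + 1) * R)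
    simp_rw [hDW]
    rw [h]; exact hE
  -- a weighted quiet slice (t47-Q)
  obtain ⟨s, hs, hFs, hGs⟩ := hQ (fun x => ‖W x‖ ^ 2) (fun x => ‖fderiv ℝ W x‖ ^ 2)
    (hWc.continuous.norm.pow 2) ((hWc.continuous_fderiv one_ne_zero).norm.pow 2)
    (fun x => sq_nonneg _) (fun x => sq_nonneg _) R Λ ((Λ + 1) * R) η X Y hR hΛ hη hη1 hX hY hA' hE'
  refine ⟨s, hs, ?_⟩
  have hsR : R ≤ s := hs.1
  have hspos : 0 < s := hR.trans_le hsR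
  -- the anomalous point on it, rotated
  obtain ⟨y₁, hy₁e, hy₁R, hy₁V⟩ := hcross s hs
  set y₁' : EuclideanSpace ℝ (Fin 3) := Rot y₁ with hy₁'
  have hy₁'2 : y₁' 2 = s := by
    rw [← EuclideanSpace.inner_basisFun_real (x := y₁') (i := 2), ← he₂, hy₁', ← hRot, Rot.inner_map_map, hy₁e]
  have hy₁'n : ‖y₁'‖ ≤ Λ * R := by rw [hy₁', Rot.norm_map]; exact hy₁R
  have hm : 0 < γ * s := mul_pos hγ hspos
  have hWy : γ * s ≤ ‖W y₁'‖ := by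
    have h2 : W y₁' = V y₁ := by simp [hW, hy₁']
    rw [h2]; exact hy₁V
  have hWy0 : 0 < ‖W y₁'‖ := hm.trans_le hWy
  -- the unit vector `u = W y₁' / ‖W y₁'‖`
  set u : EuclideanSpace ℝ (Fin 3) := (‖W y₁'‖⁻¹ : ℝ) • W y₁' with hu
  have hu1 : ‖u‖ = 1 := by
    rw [hu, norm_smul, norm_inv, norm_norm, inv_mul_cancel₀ hWy0.ne']
  -- the scalar through the `ℂ`-chart at `y₁'`
  set ψ : ℂ → ℝ := fun z =>
    ⟪W (y₁' + z.re • EuclideanSpace.basisFun (Fin 3) ℝ 0 + z.im • EuclideanSpace.basisFun (Fin 3) ℝ 1), u⟫ with hψ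
  have hψc : ContDiff ℝ 1 ψ := contDiff_comp_cchart (f := fun x => ⟪W x, u⟫) (hWc.inner ℝ contDiff_const) y₁'
  have hψ0 : γ * s ≤ ψ 0 := by
    have h0 : ψ 0 = ‖W y₁'‖ := by
      simp only [hψ, Complex.zero_re, Complex.zero_im, zero_smul, add_zero]
      rw [hu]; exact inner_self_normalize _
    rw [h0]; exact hWy
  -- the disc `|z| ≤ R/2` around `y₁'` fits in `B(0,(Λ+1)R)`
  have hr : 0 < R / 2 := by positivity
  have hfit : ‖y₁'‖ + R / 2 < (Λ + 1) * R := by nlinarith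
  -- gradient bound on the disc
  have hGψ : ∀ z ∈ closedBall (0 : ℂ) (R / 2), ‖fderiv ℝ ψ z‖ ≤ Gm := by
    intro z hz
    have h1 := norm_fderiv_inner_comp_cchart_le hWd hu1.le y₁' z
    refine h1.trans ?_
    rw [hDW]
    apply hGm
    rw [mem_ball, dist_zero_right, Rot.symm.norm_map]
    rw [mem_closedBall, dist_zero_right] at hz
    exact (norm_cchart_le y₁' z).trans_lt (by linarith)
  -- disc budgets from the slice budgets
  have hAψ : ∫ z in closedBall (0 : ℂ) (R / 2), ψ z ^ 2 ≤ X / (η * (Λ - 1) * R) := by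
    have h := setIntegral_cdisc_sq_inner_le hWc hu1.le hfit
    rw [hy₁'2] at h
    exact h.trans hFs
  have hEψ : ∫ z in closedBall (0 : ℂ) (R / 2), ‖fderiv ℝ ψ z‖ ^ 2 ≤
      3 * Y / (((1 + (1 - η) * (Λ - 1)) ^ 3 - 1) * R ^ 3) * s ^ 2 := by
    have h := setIntegral_cdisc_sq_norm_fderiv_inner_le hWc hu1.le hfit
    rw [hy₁'2] at h
    exact h.trans hGs
  -- the slice energy budget is positive
  have hμ : 1 < 1 + (1 - η) * (Λ - 1) := by nlinarith
  have hμ3 : 0 < (1 + (1 - η) * (Λ - 1)) ^ 3 - 1 := by nlinarith [pow_lt_pow_left₀ hμ zero_le_one three_ne_zero]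
  have hEpos : 0 < 3 * Y / (((1 + (1 - η) * (Λ - 1)) ^ 3 - 1) * R ^ 3) * s ^ 2 := by positivity
  -- the circular-mean core (t47-C)
  exact hC ψ (γ * s) Gm (X / (η * (Λ - 1) * R)) _ (R / 2) δ hψc hm hψ0 hr hδ hδ1 hEpos hGψ hAψ hEψ

/-- **THE SHARP CONDENSER, DYNAMIC FORM (t47-B′ steps (1)–(6)).**  As `exists_slice_alternative_of_crossings`, the
crossings being supplied by ONE backward similarity orbit of the cut-off flow (`‖DV‖ ≤ K`) from `‖y‖ < R` to
`‖Ψ_L y‖ ≥ ΛR`: first exit through the sphere of radius `ΛR` (t42a `exists_firstHit_of_exit`), `e` = the exit direction,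
and the first hits of the planes `⟪·,e⟫ = s` (`exists_anomalous_plane_of_exit`). [folklore;
cite: ConstantinIgnatovaVicol2026Putative, §3.4.1 for the setting] -/
theorem exists_slice_alternative_of_exit
    (hC : ∀ (ψ : ℂ → ℝ) (m G A E r δ : ℝ), ContDiff ℝ 1 ψ → 0 < m → m ≤ ψ 0 → 0 < r → 0 < δ → δ < 1 → 0 < E →
      (∀ z ∈ closedBall (0 : ℂ) r, ‖fderiv ℝ ψ z‖ ≤ G) →
      (∫ z in closedBall (0 : ℂ) r, ψ z ^ 2 ≤ A) →
      (∫ z in closedBall (0 : ℂ) r, ‖fderiv ℝ ψ z‖ ^ 2 ≤ E) →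
      (1 - δ) * m ≤ Real.sqrt (2 * A / Real.pi) / r ∨
        δ * m / r * Real.exp (2 * Real.pi * ((1 - δ) * m - Real.sqrt (2 * A / Real.pi) / r) ^ 2 / E) ≤ G)
    (hQ : ∀ (F G : EuclideanSpace ℝ (Fin 3) → ℝ), Continuous F → Continuous G → (∀ x, 0 ≤ F x) → (∀ x, 0 ≤ G x) →
      ∀ (R Λ R' η X Y : ℝ), 0 < R → 1 < Λ → 0 < η → η < 1 → 0 < X → 0 < Y →
        (∫ x in ball (0 : EuclideanSpace ℝ (Fin 3)) R', F x ≤ X) →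
        (∫ x in ball (0 : EuclideanSpace ℝ (Fin 3)) R', G x ≤ Y) →
        ∃ s ∈ Icc R (Λ * R),
          ∫ a, (ball (0 : EuclideanSpace ℝ (Fin 3)) R').indicator F (plane s a) ≤ X / (η * (Λ - 1) * R) ∧
          ∫ a, (ball (0 : EuclideanSpace ℝ (Fin 3)) R').indicator G (plane s a) ≤
            3 * Y / (((1 + (1 - η) * (Λ - 1)) ^ 3 - 1) * R ^ 3) * s ^ 2)
    {γ : ℝ} {V : EuclideanSpace ℝ (Fin 3) → EuclideanSpace ℝ (Fin 3)} (hV : ContDiff ℝ 1 V)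
    {K : ℝ} (hK : ∀ y, ‖fderiv ℝ V y‖ ≤ K)
    {R Λ η δ X Y Gm : ℝ} (hγ : 0 < γ) (hR : 0 < R) (hΛ : 1 < Λ) (hη : 0 < η) (hη1 : η < 1)
    (hδ : 0 < δ) (hδ1 : δ < 1) (hX : 0 < X) (hY : 0 < Y)
    (hA : ∫ x in ball (0 : EuclideanSpace ℝ (Fin 3)) ((Λ + 1) * R), ‖V x‖ ^ 2 ≤ X)
    (hE : ∫ x in ball (0 : EuclideanSpace ℝ (Fin 3)) ((Λ + 1) * R), ‖fderiv ℝ V x‖ ^ 2 ≤ Y)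
    (hGm : ∀ z ∈ ball (0 : EuclideanSpace ℝ (Fin 3)) ((Λ + 1) * R), ‖fderiv ℝ V z‖ ≤ Gm)
    {y : EuclideanSpace ℝ (Fin 3)} (hy : ‖y‖ < R) {L : ℝ} (hL : 0 ≤ L)
    (hexit : Λ * R ≤ ‖ODE.evolutionMap (fun _ : ℝ => selfSimilarTransport γ 0 V) 0 (-L) y‖) :
    ∃ s ∈ Icc R (Λ * R),
      (1 - δ) * (γ * s) ≤ Real.sqrt (2 * (X / (η * (Λ - 1) * R)) / Real.pi) / (R / 2) ∨
        δ * (γ * s) / (R / 2) *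
            Real.exp (2 * Real.pi * ((1 - δ) * (γ * s) - Real.sqrt (2 * (X / (η * (Λ - 1) * R)) / Real.pi) / (R / 2)) ^ 2 /
              (3 * Y / (((1 + (1 - η) * (Λ - 1)) ^ 3 - 1) * R ^ 3) * s ^ 2)) ≤ Gm := by
  have hΛR : 0 < Λ * R := mul_pos (by linarith) hR
  have hyΛ : ‖y‖ < Λ * R := hy.trans_le (by nlinarith)
  -- first exit through the sphere of radius `ΛR`
  obtain ⟨σ₁, hσ₁, hlt, heq⟩ := exists_firstHit_of_exit (γ := γ) hV hK hL hyΛ hexit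
  set z : EuclideanSpace ℝ (Fin 3) := ODE.evolutionMap (fun _ : ℝ => selfSimilarTransport γ 0 V) 0 (-σ₁) y with hz
  set e : EuclideanSpace ℝ (Fin 3) := (Λ * R)⁻¹ • z with he
  have he1 : ‖e‖ = 1 := by
    rw [he, norm_smul, norm_inv, Real.norm_eq_abs, abs_of_pos hΛR, heq, inv_mul_cancel₀ hΛR.ne']
  -- every plane `⟪x, e⟫ = s`, `s ∈ [R, ΛR]`, is crossed anomalously inside `B̄(0, ΛR)`
  have hcross : ∀ s ∈ Icc R (Λ * R),
      ∃ y₁ : EuclideanSpace ℝ (Fin 3), ⟪y₁, e⟫ = s ∧ ‖y₁‖ ≤ Λ * R ∧ γ * s ≤ ‖V y₁‖ := by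
    intro s hs
    have hys : ⟪y, e⟫ < s := by
      have h1 : ⟪y, e⟫ ≤ ‖y‖ * ‖e‖ := real_inner_le_norm y e
      rw [he1, mul_one] at h1
      linarith [hs.1]
    have hzs : s ≤ ⟪z, e⟫ := by
      have h1 : ⟪z, e⟫ = Λ * R := by
        rw [he, real_inner_smul_right, real_inner_self_eq_norm_sq, heq]
        field_simp
      rw [h1]; exact hs.2
    obtain ⟨σ₂, hσ₂, heq₂, -, hV₂⟩ := exists_anomalous_plane_of_exit (γ := γ) hV hK he1 hσ₁.1.le hys hzs
    refine ⟨_, heq₂, ?_, hV₂⟩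
    rcases hσ₂.2.lt_or_eq with hlt₂ | heq₂'
    · exact (hlt σ₂ ⟨hσ₂.1.le, hlt₂⟩).le
    · rw [heq₂']; exact heq.le
  exact exists_slice_alternative_of_crossings hC hQ hV he1 hγ hR hΛ hη hη1 hδ hδ1 hX hY hA hE hGm hcross

end Summit.NavierStokesRegularity.NavierStokesRegularity.Theorems.PowerGaugeEulerLiouville.Condenser

end
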